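import Mathlib.LinearAlgebra.Matrix.FixedDetMatrices
import Mathlib.NumberTheory.ModularForms.CongruenceSubgroups
import Literature.NumberTheory.EllipticCurves.ModularCurveGamma0IndexProofs
import HarnessLib

/-!
# The top congruence layer of `SL₂(ℤ/p^e)` and its conjugation table

For a prime `p` and `e ≥ 2` put `ϖ = p^{e-1} ∈ ℤ/p^e`, so `ϖ² = 0` and `pϖ = 0`.  The kernel of the reduction
`SL₂(ℤ/p^e) → SL₂(ℤ/p^{e-1})` is `1 + ϖ·𝔰𝔩₂(𝔽_p)`: the elementary abelian group of order `p³` on the commuting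
elements `ē = (1 ϖ; 0 1) = T̄^{p^{e-1}}`, `f̄ = (1 0; ϖ 1) = L̄^{p^{e-1}}`, `h̄ = (1+ϖ 0; 0 1-ϖ)`
(`exists_eq_pow_mul_pow_mul_pow`, `dvd_of_pow_mul_pow_mul_pow_eq_one`), on which `SL₂(ℤ/p^e)` acts through
the adjoint action of `SL₂(𝔽_p)` — this is the isomorphism `G(p^k)/G(p^{k+1}) ≃ M₀(𝔽_p)` used in
[CalegariDimitrovTang2025, §4.5, proof of Lemma 4.5.6].  We record that action as a CONJUGATION TABLE for
`T̄ = (1 1; 0 1)`, `L̄ = (1 0; 1 1)`, `S̄ = T̄⁻¹ L̄ T̄⁻¹` and the torus element `D̄ = diag(2, 2⁻¹)` (`p` odd: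
`D̄ T̄ D̄⁻¹ = T̄⁴`, `D̄ L̄ D̄⁻¹ = L̄^b` with `4b = 1`), together with `SL₂(ℤ/N) = ⟨T̄, L̄⟩` ([DiamondShurman2005,
Exercise 1.1.1] pushed through the surjective reduction, tree `specialLinearGroup_map_surjective`) and the
compatibility of the reductions `ℤ → ℤ/N → ℤ/d`.

Design: NO definitions — every statement is in HYPOTHESIS FORM, the matrices entering through equations
`(X : Matrix (Fin 2) (Fin 2) R) = !![…]`, and the identities needing only `ϖ² = 0` are proved over an arbitrary
commutative ring `R`.  This is the matrix input of the descent along the congruence filtration in a central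
extension of `SL₂(ℤ/p^e)` (sequel files `SL2PrimePowCentralExtension*`), which proves that the `p`-primary part
of the Schur multiplier of `SL₂(ℤ/p^e)` vanishes for `p ≥ 5` [Beyl1986] — the group theory behind
[CalegariDimitrovTang2025, Corollary 4.5.3] at prime-power level.  Nothing about `p = 2, 3` specifics here.
-/

open scoped MatrixGroups
open Matrix Matrix.SpecialLinearGroup

namespace Literature.GroupTheory.ArithmeticGroups

namespace SL2TopLayer

section anyring

variable {R : Type*} [CommRing R] (ϖ : R)
variable (T L Eb Fb Hb : SL(2, R))

/-- Powers of an upper unipotent: `(1 1; 0 1)ⁿ = (1 n; 0 1)` in `SL₂(R)`. [cite: CalegariDimitrovTang2025, §4.5,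
proof of Lemma 4.5.6] -/
theorem tBar_pow (hT : (T : Matrix (Fin 2) (Fin 2) R) = !![1, 1; 0, 1]) (n : ℕ) :
    ((T ^ n : SL(2, R)) : Matrix (Fin 2) (Fin 2) R) = !![1, (n : R); 0, 1] := by
  induction n with
  | zero => ext i j; fin_cases i <;> fin_cases j <;> simp
  | succ n ih =>
    rw [pow_succ, coe_mul, ih, hT]
    ext i j; fin_cases i <;> fin_cases j <;> simp [Matrix.mul_apply, Fin.sum_univ_two]
    ring

/-- Powers of a lower unipotent: `(1 0; 1 1)ⁿ = (1 0; n 1)`. [cite: CalegariDimitrovTang2025, §4.5, proof of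
Lemma 4.5.6] -/
theorem lBar_pow (hL : (L : Matrix (Fin 2) (Fin 2) R) = !![1, 0; 1, 1]) (n : ℕ) :
    ((L ^ n : SL(2, R)) : Matrix (Fin 2) (Fin 2) R) = !![1, 0; (n : R), 1] := by
  induction n with
  | zero => ext i j; fin_cases i <;> fin_cases j <;> simp
  | succ n ih =>
    rw [pow_succ, coe_mul, ih, hL]
    ext i j; fin_cases i <;> fin_cases j <;> simp [Matrix.mul_apply, Fin.sum_univ_two]

/-- `(1 ϖ; 0 1)ⁿ = (1 nϖ; 0 1)`. [cite: CalegariDimitrovTang2025, §4.5, proof of Lemma 4.5.6] -/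
theorem eBar_pow (hE : (Eb : Matrix (Fin 2) (Fin 2) R) = !![1, ϖ; 0, 1]) (n : ℕ) :
    ((Eb ^ n : SL(2, R)) : Matrix (Fin 2) (Fin 2) R) = !![1, (n : R) * ϖ; 0, 1] := by
  induction n with
  | zero => ext i j; fin_cases i <;> fin_cases j <;> simp
  | succ n ih =>
    rw [pow_succ, coe_mul, ih, hE]
    ext i j; fin_cases i <;> fin_cases j <;> simp [Matrix.mul_apply, Fin.sum_univ_two]
    ring

/-- `(1 0; ϖ 1)ⁿ = (1 0; nϖ 1)`. [cite: CalegariDimitrovTang2025, §4.5, proof of Lemma 4.5.6] -/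
theorem fBar_pow (hF : (Fb : Matrix (Fin 2) (Fin 2) R) = !![1, 0; ϖ, 1]) (n : ℕ) :
    ((Fb ^ n : SL(2, R)) : Matrix (Fin 2) (Fin 2) R) = !![1, 0; (n : R) * ϖ, 1] := by
  induction n with
  | zero => ext i j; fin_cases i <;> fin_cases j <;> simp
  | succ n ih =>
    rw [pow_succ, coe_mul, ih, hF]
    ext i j; fin_cases i <;> fin_cases j <;> simp [Matrix.mul_apply, Fin.sum_univ_two]
    ring

/-- `(1+ϖ 0; 0 1-ϖ)ⁿ = (1+nϖ 0; 0 1-nϖ)` when `ϖ² = 0` (binomial theorem). [cite: CalegariDimitrovTang2025,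
§4.5, proof of Lemma 4.5.6] -/
theorem hBar_pow (hϖ : ϖ * ϖ = 0) (hH : (Hb : Matrix (Fin 2) (Fin 2) R) = !![1 + ϖ, 0; 0, 1 - ϖ]) (n : ℕ) :
    ((Hb ^ n : SL(2, R)) : Matrix (Fin 2) (Fin 2) R) = !![1 + (n : R) * ϖ, 0; 0, 1 - (n : R) * ϖ] := by
  induction n with
  | zero => ext i j; fin_cases i <;> fin_cases j <;> simp
  | succ n ih =>
    rw [pow_succ, coe_mul, ih, hH]
    ext i j; fin_cases i <;> fin_cases j <;> simp [Matrix.mul_apply, Fin.sum_univ_two] <;> grind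

/-- `ē = (1 ϖ; 0 1)` and `f̄ = (1 0; ϖ 1)` commute when `ϖ² = 0`: the layer `1 + ϖ·𝔰𝔩₂` is abelian. [cite:
CalegariDimitrovTang2025, §4.5, proof of Lemma 4.5.6] -/
theorem eBar_mul_fBar (hϖ : ϖ * ϖ = 0) (hE : (Eb : Matrix (Fin 2) (Fin 2) R) = !![1, ϖ; 0, 1])
    (hF : (Fb : Matrix (Fin 2) (Fin 2) R) = !![1, 0; ϖ, 1]) : Eb * Fb = Fb * Eb := by
  ext i j; fin_cases i <;> fin_cases j <;>
    simp [hE, hF, Matrix.mul_apply, Fin.sum_univ_two] <;> grind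

/-- `ē` and `h̄ = (1+ϖ 0; 0 1-ϖ)` commute when `ϖ² = 0`. [cite: CalegariDimitrovTang2025, §4.5, proof of Lemma
4.5.6] -/
theorem eBar_mul_hBar (hϖ : ϖ * ϖ = 0) (hE : (Eb : Matrix (Fin 2) (Fin 2) R) = !![1, ϖ; 0, 1])
    (hH : (Hb : Matrix (Fin 2) (Fin 2) R) = !![1 + ϖ, 0; 0, 1 - ϖ]) : Eb * Hb = Hb * Eb := by
  ext i j; fin_cases i <;> fin_cases j <;>
    simp [hE, hH, Matrix.mul_apply, Fin.sum_univ_two]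
  grind

/-- `f̄` and `h̄` commute when `ϖ² = 0`. [cite: CalegariDimitrovTang2025, §4.5, proof of Lemma 4.5.6] -/
theorem fBar_mul_hBar (hϖ : ϖ * ϖ = 0) (hF : (Fb : Matrix (Fin 2) (Fin 2) R) = !![1, 0; ϖ, 1])
    (hH : (Hb : Matrix (Fin 2) (Fin 2) R) = !![1 + ϖ, 0; 0, 1 - ϖ]) : Fb * Hb = Hb * Fb := by
  ext i j; fin_cases i <;> fin_cases j <;>
    simp [hF, hH, Matrix.mul_apply, Fin.sum_univ_two]
  grind

/-- Conjugation table, `Ad(T) e = e`: `T̄ ē T̄⁻¹ = ē`. [cite: CalegariDimitrovTang2025, §4.5, proof of Lemma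
4.5.6] -/
theorem tBar_conj_eBar (hT : (T : Matrix (Fin 2) (Fin 2) R) = !![1, 1; 0, 1])
    (hE : (Eb : Matrix (Fin 2) (Fin 2) R) = !![1, ϖ; 0, 1]) : T * Eb * T⁻¹ = Eb := by
  ext i j; fin_cases i <;> fin_cases j <;> simp [hE, hT, Matrix.mul_apply, Fin.sum_univ_two,
    Matrix.SpecialLinearGroup.coe_inv, Matrix.adjugate_fin_two]

/-- Conjugation table, `Ad(T) h = h - 2e`: `T̄ h̄ T̄⁻¹ = h̄ ē⁻¹ ē⁻¹` (`ϖ² = 0`). [cite: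
CalegariDimitrovTang2025, §4.5, proof of Lemma 4.5.6] -/
theorem tBar_conj_hBar (hϖ : ϖ * ϖ = 0) (hT : (T : Matrix (Fin 2) (Fin 2) R) = !![1, 1; 0, 1])
    (hE : (Eb : Matrix (Fin 2) (Fin 2) R) = !![1, ϖ; 0, 1])
    (hH : (Hb : Matrix (Fin 2) (Fin 2) R) = !![1 + ϖ, 0; 0, 1 - ϖ]) :
    T * Hb * T⁻¹ = Hb * Eb⁻¹ * Eb⁻¹ := by
  ext i j; fin_cases i <;> fin_cases j <;>
    simp [hH, hT, hE, Matrix.mul_apply, Fin.sum_univ_two, Matrix.SpecialLinearGroup.coe_inv,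
      Matrix.adjugate_fin_two]
  grind

/-- Conjugation table, `Ad(T) f = f + h - e`: `T̄ f̄ T̄⁻¹ = f̄ h̄ ē⁻¹` (`ϖ² = 0`). [cite:
CalegariDimitrovTang2025, §4.5, proof of Lemma 4.5.6] -/
theorem tBar_conj_fBar (hϖ : ϖ * ϖ = 0) (hT : (T : Matrix (Fin 2) (Fin 2) R) = !![1, 1; 0, 1])
    (hE : (Eb : Matrix (Fin 2) (Fin 2) R) = !![1, ϖ; 0, 1]) (hF : (Fb : Matrix (Fin 2) (Fin 2) R) = !![1, 0; ϖ, 1])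
    (hH : (Hb : Matrix (Fin 2) (Fin 2) R) = !![1 + ϖ, 0; 0, 1 - ϖ]) :
    T * Fb * T⁻¹ = Fb * Hb * Eb⁻¹ := by
  ext i j; fin_cases i <;> fin_cases j <;>
    simp [hH, hT, hF, hE, Matrix.mul_apply, Fin.sum_univ_two,
      Matrix.SpecialLinearGroup.coe_inv, Matrix.adjugate_fin_two] <;> grind

/-- Conjugation table, `Ad(L) f = f`: `L̄ f̄ L̄⁻¹ = f̄`. [cite: CalegariDimitrovTang2025, §4.5, proof of Lemma
4.5.6] -/
theorem lBar_conj_fBar (hL : (L : Matrix (Fin 2) (Fin 2) R) = !![1, 0; 1, 1])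
    (hF : (Fb : Matrix (Fin 2) (Fin 2) R) = !![1, 0; ϖ, 1]) : L * Fb * L⁻¹ = Fb := by
  ext i j; fin_cases i <;> fin_cases j <;> simp [hF, hL, Matrix.mul_apply, Fin.sum_univ_two,
    Matrix.SpecialLinearGroup.coe_inv, Matrix.adjugate_fin_two]

/-- Conjugation table, `Ad(L) h = h + 2f`: `L̄ h̄ L̄⁻¹ = h̄ f̄ f̄` (`ϖ² = 0`). [cite: CalegariDimitrovTang2025,
§4.5, proof of Lemma 4.5.6] -/
theorem lBar_conj_hBar (hϖ : ϖ * ϖ = 0) (hL : (L : Matrix (Fin 2) (Fin 2) R) = !![1, 0; 1, 1])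
    (hF : (Fb : Matrix (Fin 2) (Fin 2) R) = !![1, 0; ϖ, 1])
    (hH : (Hb : Matrix (Fin 2) (Fin 2) R) = !![1 + ϖ, 0; 0, 1 - ϖ]) :
    L * Hb * L⁻¹ = Hb * Fb * Fb := by
  ext i j; fin_cases i <;> fin_cases j <;>
    simp [hH, hL, hF, Matrix.mul_apply, Fin.sum_univ_two, Matrix.SpecialLinearGroup.coe_inv,
      Matrix.adjugate_fin_two]
  grind

/-- Conjugation table, `Ad(L) e = e - h - f`: `L̄ ē L̄⁻¹ = ē h̄⁻¹ f̄⁻¹` (`ϖ² = 0`). [cite: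
CalegariDimitrovTang2025, §4.5, proof of Lemma 4.5.6] -/
theorem lBar_conj_eBar (hϖ : ϖ * ϖ = 0) (hL : (L : Matrix (Fin 2) (Fin 2) R) = !![1, 0; 1, 1])
    (hE : (Eb : Matrix (Fin 2) (Fin 2) R) = !![1, ϖ; 0, 1]) (hF : (Fb : Matrix (Fin 2) (Fin 2) R) = !![1, 0; ϖ, 1])
    (hH : (Hb : Matrix (Fin 2) (Fin 2) R) = !![1 + ϖ, 0; 0, 1 - ϖ]) :
    L * Eb * L⁻¹ = Eb * Hb⁻¹ * Fb⁻¹ := by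
  ext i j; fin_cases i <;> fin_cases j <;>
    simp [hH, hL, hF, hE, Matrix.mul_apply, Fin.sum_univ_two,
      Matrix.SpecialLinearGroup.coe_inv, Matrix.adjugate_fin_two] <;> grind

/-- For `S̄ := T̄⁻¹ L̄ T̄⁻¹ = (0 -1; 1 0)`: `S̄ T̄ S̄⁻¹ = L̄⁻¹`. [cite: CalegariDimitrovTang2025, §4.5, proof of
Lemma 4.5.6] -/
theorem sBar_conj_tBar (hT : (T : Matrix (Fin 2) (Fin 2) R) = !![1, 1; 0, 1])
    (hL : (L : Matrix (Fin 2) (Fin 2) R) = !![1, 0; 1, 1]) :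
    T⁻¹ * L * T⁻¹ * T * (T⁻¹ * L * T⁻¹)⁻¹ = L⁻¹ := by
  ext i j; fin_cases i <;> fin_cases j <;>
    simp [hL, hT, Matrix.mul_apply, Fin.sum_univ_two, Matrix.SpecialLinearGroup.coe_inv,
      Matrix.adjugate_fin_two]

/-- For `S̄ := T̄⁻¹ L̄ T̄⁻¹`: `S̄ L̄ S̄⁻¹ = T̄⁻¹`. [cite: CalegariDimitrovTang2025, §4.5, proof of Lemma 4.5.6]
-/
theorem sBar_conj_lBar (hT : (T : Matrix (Fin 2) (Fin 2) R) = !![1, 1; 0, 1])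
    (hL : (L : Matrix (Fin 2) (Fin 2) R) = !![1, 0; 1, 1]) :
    T⁻¹ * L * T⁻¹ * L * (T⁻¹ * L * T⁻¹)⁻¹ = T⁻¹ := by
  ext i j; fin_cases i <;> fin_cases j <;>
    simp [hL, hT, Matrix.mul_apply, Fin.sum_univ_two, Matrix.SpecialLinearGroup.coe_inv,
      Matrix.adjugate_fin_two]


/-- `ē^b h̄^a f̄^c = (1+aϖ bϖ; cϖ 1-aϖ)` when `ϖ² = 0`. [cite: CalegariDimitrovTang2025, §4.5, proof of Lemma
4.5.6] -/
theorem eBar_pow_mul_hBar_pow_mul_fBar_pow (hϖ : ϖ * ϖ = 0)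
    (hE : (Eb : Matrix (Fin 2) (Fin 2) R) = !![1, ϖ; 0, 1]) (hF : (Fb : Matrix (Fin 2) (Fin 2) R) = !![1, 0; ϖ, 1])
    (hH : (Hb : Matrix (Fin 2) (Fin 2) R) = !![1 + ϖ, 0; 0, 1 - ϖ]) (a b c : ℕ) :
    ((Eb ^ b * Hb ^ a * Fb ^ c : SL(2, R)) : Matrix (Fin 2) (Fin 2) R) =
      !![1 + (a : R) * ϖ, (b : R) * ϖ; (c : R) * ϖ, 1 - (a : R) * ϖ] := by
  rw [coe_mul, coe_mul, eBar_pow ϖ Eb hE, hBar_pow ϖ Hb hϖ hH, fBar_pow ϖ Fb hF]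
  ext i j; fin_cases i <;> fin_cases j <;> simp [Matrix.mul_apply, Fin.sum_univ_two] <;> grind


/-- Torus action on the root group: `D̄ T̄ D̄⁻¹ = T̄⁴` for `D̄ = diag(2, u)`, `2u = 1`. [cite:
CalegariDimitrovTang2025, §4.5, proof of Lemma 4.5.6] -/
theorem dBar_conj_tBar {u : R} (hu : 2 * u = 1) (D : SL(2, R))
    (hD : (D : Matrix (Fin 2) (Fin 2) R) = !![2, 0; 0, u])
    (hT : (T : Matrix (Fin 2) (Fin 2) R) = !![1, 1; 0, 1]) : D * T * D⁻¹ = T ^ 4 := by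
  ext i j
  rw [tBar_pow T hT]
  fin_cases i <;> fin_cases j <;>
    simp [hD, hT, Matrix.mul_apply, Fin.sum_univ_two, Matrix.SpecialLinearGroup.coe_inv,
      Matrix.adjugate_fin_two] <;> grind

/-- Torus action on the opposite root group: `D̄ L̄ D̄⁻¹ = L̄^b` for `D̄ = diag(2, u)`, `2u = 1`, `b ≡ u²`.
[cite: CalegariDimitrovTang2025, §4.5, proof of Lemma 4.5.6] -/
theorem dBar_conj_lBar {u : R} (hu : 2 * u = 1) (D : SL(2, R))
    (hD : (D : Matrix (Fin 2) (Fin 2) R) = !![2, 0; 0, u])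
    (hL : (L : Matrix (Fin 2) (Fin 2) R) = !![1, 0; 1, 1]) {b : ℕ} (hb : (b : R) = u * u) :
    D * L * D⁻¹ = L ^ b := by
  ext i j
  rw [lBar_pow L hL, hb]
  fin_cases i <;> fin_cases j <;>
    simp [hD, hL, Matrix.mul_apply, Fin.sum_univ_two, Matrix.SpecialLinearGroup.coe_inv,
      Matrix.adjugate_fin_two] <;> grind

end anyring

section zmod

variable (p e : ℕ)

/-- `ϖ² = 0` in `ℤ/p^e` for `ϖ = p^{e-1}` and `e ≥ 2` (as `2(e-1) ≥ e`). [cite: CalegariDimitrovTang2025, §4.5,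
proof of Lemma 4.5.6] -/
theorem varpi_mul_varpi (he : 2 ≤ e) :
    (p : ZMod (p ^ e)) ^ (e - 1) * (p : ZMod (p ^ e)) ^ (e - 1) = 0 := by
  rw [← Nat.cast_pow, ← Nat.cast_mul, ZMod.natCast_eq_zero_iff, ← pow_add]
  exact pow_dvd_pow p (by omega)

/-- `p · ϖ = 0` in `ℤ/p^e` for `ϖ = p^{e-1}`. [cite: CalegariDimitrovTang2025, §4.5, proof of Lemma 4.5.6] -/
theorem natCast_mul_varpi (he : 1 ≤ e) : (p : ZMod (p ^ e)) * (p : ZMod (p ^ e)) ^ (e - 1) = 0 := by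
  rw [← Nat.cast_pow, ← Nat.cast_mul, ZMod.natCast_eq_zero_iff, ← pow_succ']
  exact pow_dvd_pow p (by omega)

/-- `a · ϖ = 0` in `ℤ/p^e` iff `p ∣ a` (`ϖ = p^{e-1}`, `a ∈ ℕ`). [cite: CalegariDimitrovTang2025, §4.5, proof of
Lemma 4.5.6] -/
theorem natCast_mul_varpi_eq_zero_iff (hp : p.Prime) (he : 1 ≤ e) (a : ℕ) :
    (a : ZMod (p ^ e)) * (p : ZMod (p ^ e)) ^ (e - 1) = 0 ↔ p ∣ a := by
  rw [← Nat.cast_pow, ← Nat.cast_mul, ZMod.natCast_eq_zero_iff]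
  obtain ⟨k, rfl⟩ := Nat.exists_eq_add_of_le he
  rw [Nat.add_sub_cancel_left, show p ^ (1 + k) = p ^ k * p by ring, mul_comm a]
  exact Nat.mul_dvd_mul_iff_left (pow_pos hp.pos k)

end zmod

section torsion

variable {R : Type*} [CommRing R] (ϖ : R) (p : ℕ)


/-- An element of `SL₂(R)` whose powers are `1 + nϖY` has order dividing `p` when `pϖ = 0`. [cite:
CalegariDimitrovTang2025, §4.5, proof of Lemma 4.5.6] -/
theorem pow_eq_one_of_coe_pow (hp : (p : R) * ϖ = 0) (X : SL(2, R)) {x01 x10 x00 : R}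
    (hX : ∀ n : ℕ, ((X ^ n : SL(2, R)) : Matrix (Fin 2) (Fin 2) R) =
      !![1 + (n : R) * x00 * ϖ, (n : R) * x01 * ϖ; (n : R) * x10 * ϖ, 1 - (n : R) * x00 * ϖ]) :
    X ^ p = 1 := by
  have h : ∀ y : R, (p : R) * y * ϖ = 0 := fun y ↦ by rw [mul_right_comm, hp, zero_mul]
  ext i j
  rw [hX p]
  fin_cases i <;> fin_cases j <;> simp [h]

/-- `ē^p = 1` when `pϖ = 0`. [cite: CalegariDimitrovTang2025, §4.5, proof of Lemma 4.5.6] -/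
theorem eBar_pow_p (hp : (p : R) * ϖ = 0) (Eb : SL(2, R)) (hE : (Eb : Matrix (Fin 2) (Fin 2) R) = !![1, ϖ; 0, 1]) :
    Eb ^ p = 1 :=
  pow_eq_one_of_coe_pow ϖ p hp Eb (x01 := 1) (x10 := 0) (x00 := 0) fun n ↦ by
    rw [eBar_pow ϖ Eb hE]; ext i j; fin_cases i <;> fin_cases j <;> simp

/-- `f̄^p = 1` when `pϖ = 0`. [cite: CalegariDimitrovTang2025, §4.5, proof of Lemma 4.5.6] -/
theorem fBar_pow_p (hp : (p : R) * ϖ = 0) (Fb : SL(2, R)) (hF : (Fb : Matrix (Fin 2) (Fin 2) R) = !![1, 0; ϖ, 1]) :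
    Fb ^ p = 1 :=
  pow_eq_one_of_coe_pow ϖ p hp Fb (x01 := 0) (x10 := 1) (x00 := 0) fun n ↦ by
    rw [fBar_pow ϖ Fb hF]; ext i j; fin_cases i <;> fin_cases j <;> simp

/-- `h̄^p = 1` when `ϖ² = 0` and `pϖ = 0`. [cite: CalegariDimitrovTang2025, §4.5, proof of Lemma 4.5.6] -/
theorem hBar_pow_p (hϖ : ϖ * ϖ = 0) (hp : (p : R) * ϖ = 0) (Hb : SL(2, R))
    (hH : (Hb : Matrix (Fin 2) (Fin 2) R) = !![1 + ϖ, 0; 0, 1 - ϖ]) : Hb ^ p = 1 :=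
  pow_eq_one_of_coe_pow ϖ p hp Hb (x01 := 0) (x10 := 0) (x00 := 1) fun n ↦ by
    rw [hBar_pow ϖ Hb hϖ hH]; ext i j; fin_cases i <;> fin_cases j <;> simp

end torsion

section layer

variable (p e : ℕ)

/-- An element of `ℤ/p^e` reducing to `0` in `ℤ/p^{e-1}` is a multiple of `ϖ = p^{e-1}`. [cite:
CalegariDimitrovTang2025, §4.5, proof of Lemma 4.5.6] -/
theorem exists_eq_mul_varpi [Fact p.Prime] {x : ZMod (p ^ e)}
    (hx : ZMod.castHom (pow_dvd_pow p (Nat.sub_le e 1)) (ZMod (p ^ (e - 1))) x = 0) :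
    ∃ y : ZMod (p ^ e), x = y * (p : ZMod (p ^ e)) ^ (e - 1) := by
  haveI : NeZero (p ^ e) := ⟨pow_ne_zero _ (Fact.out : p.Prime).ne_zero⟩
  rw [ZMod.castHom_apply, ZMod.cast_eq_val, ZMod.natCast_eq_zero_iff] at hx
  obtain ⟨k, hk⟩ := hx
  refine ⟨k, ?_⟩
  rw [← ZMod.natCast_zmod_val x, hk, Nat.cast_mul, Nat.cast_pow, mul_comm]


/-- Every `1 + ϖX ∈ SL₂(ℤ/p^e)` lies in the kernel of the reduction `SL₂(ℤ/p^e) → SL₂(ℤ/p^{e-1})`. [cite: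
CalegariDimitrovTang2025, §4.5, proof of Lemma 4.5.6] -/
theorem map_castHom_eq_one_of_coe (X : SL(2, ZMod (p ^ e))) {x00 x01 x10 x11 : ZMod (p ^ e)}
    (hX : (X : Matrix (Fin 2) (Fin 2) (ZMod (p ^ e))) =
      !![1 + x00 * (p : ZMod (p ^ e)) ^ (e - 1), x01 * (p : ZMod (p ^ e)) ^ (e - 1);
         x10 * (p : ZMod (p ^ e)) ^ (e - 1), 1 + x11 * (p : ZMod (p ^ e)) ^ (e - 1)]) :
    Matrix.SpecialLinearGroup.map (ZMod.castHom (pow_dvd_pow p (Nat.sub_le e 1)) (ZMod (p ^ (e - 1)))) X = 1 := by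
  have hϖ : ZMod.castHom (pow_dvd_pow p (Nat.sub_le e 1)) (ZMod (p ^ (e - 1))) ((p : ZMod (p ^ e)) ^ (e - 1)) = 0 := by
    rw [map_pow, map_natCast, ← Nat.cast_pow, ZMod.natCast_self]
  ext i j; fin_cases i <;> fin_cases j <;>
    simp [hX, -ZMod.castHom_apply, map_one, map_add, map_mul, hϖ]


/-- **Structure of the top congruence layer** (`e ≥ 2`): every `M ∈ SL₂(ℤ/p^e)` with trivial reduction modulo
`p^{e-1}` is `ē^b h̄^a f̄^c` for some `a, b, c ∈ ℕ` — write `M = 1 + ϖX`; `det M = 1` forces `tr X ≡ 0`. This is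
`G(p^{e-1})/G(p^e) ≃ M₀(𝔽_p)` of the cited proof. [cite: CalegariDimitrovTang2025, §4.5, proof of Lemma 4.5.6]
-/
theorem exists_eq_pow_mul_pow_mul_pow [Fact p.Prime] (he : 2 ≤ e) (Eb Fb Hb : SL(2, ZMod (p ^ e)))
    (hE : (Eb : Matrix (Fin 2) (Fin 2) (ZMod (p ^ e))) = !![1, (p : ZMod (p ^ e)) ^ (e - 1); 0, 1])
    (hF : (Fb : Matrix (Fin 2) (Fin 2) (ZMod (p ^ e))) = !![1, 0; (p : ZMod (p ^ e)) ^ (e - 1), 1])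
    (hH : (Hb : Matrix (Fin 2) (Fin 2) (ZMod (p ^ e))) =
      !![1 + (p : ZMod (p ^ e)) ^ (e - 1), 0; 0, 1 - (p : ZMod (p ^ e)) ^ (e - 1)])
    {M : SL(2, ZMod (p ^ e))}
    (hM : Matrix.SpecialLinearGroup.map (ZMod.castHom (pow_dvd_pow p (Nat.sub_le e 1)) (ZMod (p ^ (e - 1)))) M = 1) :
    ∃ a b c : ℕ, M = Eb ^ b * Hb ^ a * Fb ^ c := by
  set ϖ : ZMod (p ^ e) := (p : ZMod (p ^ e)) ^ (e - 1) with hϖdef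
  have hent : ∀ i j, ZMod.castHom (pow_dvd_pow p (Nat.sub_le e 1)) (ZMod (p ^ (e - 1))) (M i j) =
      (1 : Matrix (Fin 2) (Fin 2) (ZMod (p ^ (e-1)))) i j := fun i j ↦ by
    have := congr_arg (fun N : SL(2, ZMod (p ^ (e - 1))) ↦ N i j) hM
    simpa [-ZMod.castHom_apply] using this
  have h00 : ZMod.castHom (pow_dvd_pow p (Nat.sub_le e 1)) (ZMod (p ^ (e - 1))) (M 0 0 - 1) = 0 := by
    rw [map_sub, hent, map_one]; simp
  have h01 : ZMod.castHom (pow_dvd_pow p (Nat.sub_le e 1)) (ZMod (p ^ (e - 1))) (M 0 1) = 0 := by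
    rw [hent]; simp
  have h10 : ZMod.castHom (pow_dvd_pow p (Nat.sub_le e 1)) (ZMod (p ^ (e - 1))) (M 1 0) = 0 := by
    rw [hent]; simp
  have h11 : ZMod.castHom (pow_dvd_pow p (Nat.sub_le e 1)) (ZMod (p ^ (e - 1))) (M 1 1 - 1) = 0 := by
    rw [map_sub, hent, map_one]; simp
  obtain ⟨ya, hya⟩ := exists_eq_mul_varpi p e h00
  obtain ⟨yb, hyb⟩ := exists_eq_mul_varpi p e h01
  obtain ⟨yc, hyc⟩ := exists_eq_mul_varpi p e h10
  obtain ⟨yd, hyd⟩ := exists_eq_mul_varpi p e h11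
  rw [← hϖdef] at hya hyb hyc hyd
  have hdet := M.prop
  rw [Matrix.det_fin_two] at hdet
  have e00 : M 0 0 = 1 + ya * ϖ := by rw [← hya]; ring
  have e11 : M 1 1 = 1 + yd * ϖ := by rw [← hyd]; ring
  rw [e00, e11, hyb, hyc] at hdet
  have h2 : ϖ * ϖ = 0 := varpi_mul_varpi p e he
  have hd : yd * ϖ = - (ya * ϖ) := by grind
  haveI : NeZero (p ^ e) := ⟨pow_ne_zero _ (Fact.out : p.Prime).ne_zero⟩
  refine ⟨ya.val, yb.val, yc.val, ?_⟩
  ext i j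
  rw [eBar_pow_mul_hBar_pow_mul_fBar_pow ϖ Eb Fb Hb h2 hE hF hH, ZMod.natCast_zmod_val, ZMod.natCast_zmod_val,
    ZMod.natCast_zmod_val]
  fin_cases i <;> fin_cases j <;> simp [e00, e11, hyb, hyc, hd, sub_eq_add_neg]


/-- `ē^b h̄^a f̄^c = 1` in `SL₂(ℤ/p^e)` forces `p ∣ a`, `p ∣ b`, `p ∣ c`: the layer is elementary abelian of
rank `3` on `ē, h̄, f̄`. [cite: CalegariDimitrovTang2025, §4.5, proof of Lemma 4.5.6] -/
theorem dvd_of_pow_mul_pow_mul_pow_eq_one [Fact p.Prime] (he : 2 ≤ e) (Eb Fb Hb : SL(2, ZMod (p ^ e)))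
    (hE : (Eb : Matrix (Fin 2) (Fin 2) (ZMod (p ^ e))) = !![1, (p : ZMod (p ^ e)) ^ (e - 1); 0, 1])
    (hF : (Fb : Matrix (Fin 2) (Fin 2) (ZMod (p ^ e))) = !![1, 0; (p : ZMod (p ^ e)) ^ (e - 1), 1])
    (hH : (Hb : Matrix (Fin 2) (Fin 2) (ZMod (p ^ e))) =
      !![1 + (p : ZMod (p ^ e)) ^ (e - 1), 0; 0, 1 - (p : ZMod (p ^ e)) ^ (e - 1)])
    {a b c : ℕ} (h : Eb ^ b * Hb ^ a * Fb ^ c = 1) : p ∣ a ∧ p ∣ b ∧ p ∣ c := by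
  have hp : p.Prime := Fact.out
  have h1 : 1 ≤ e := by omega
  have hcoe := congr_arg (fun N : SL(2, ZMod (p ^ e)) ↦ (N : Matrix (Fin 2) (Fin 2) (ZMod (p ^ e)))) h
  rw [eBar_pow_mul_hBar_pow_mul_fBar_pow _ Eb Fb Hb (varpi_mul_varpi p e he) hE hF hH, coe_one] at hcoe
  have h01 := congr_fun₂ hcoe 0 1
  have h10 := congr_fun₂ hcoe 1 0
  have h00 := congr_fun₂ hcoe 0 0
  simp only [Matrix.of_apply, Matrix.cons_val', Matrix.cons_val_zero, Matrix.cons_val_one,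
    Matrix.cons_val_fin_one, Matrix.one_apply_eq, Matrix.one_apply_ne, ne_eq,
    zero_ne_one, one_ne_zero, not_false_eq_true, add_eq_left] at h01 h10 h00
  exact ⟨(natCast_mul_varpi_eq_zero_iff p e hp h1 a).mp h00,
    (natCast_mul_varpi_eq_zero_iff p e hp h1 b).mp h01, (natCast_mul_varpi_eq_zero_iff p e hp h1 c).mp h10⟩


/-- **Torus element** (`p` odd): there are `D̄ ∈ SL₂(ℤ/p^e)` (namely `diag(2, 2⁻¹)`) and `b ∈ ℕ` with `D̄ T̄
D̄⁻¹ = T̄⁴`, `D̄ L̄ D̄⁻¹ = L̄^b` and `4b = 1` in `ℤ/p^e`. [cite: CalegariDimitrovTang2025, §4.5, proof of Lemma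
4.5.6] -/
theorem exists_torus [Fact p.Prime] (hp2 : p ≠ 2) (T L : SL(2, ZMod (p ^ e)))
    (hT : (T : Matrix (Fin 2) (Fin 2) (ZMod (p ^ e))) = !![1, 1; 0, 1])
    (hL : (L : Matrix (Fin 2) (Fin 2) (ZMod (p ^ e))) = !![1, 0; 1, 1]) :
    ∃ (D : SL(2, ZMod (p ^ e))) (b : ℕ), D * T * D⁻¹ = T ^ 4 ∧ D * L * D⁻¹ = L ^ b ∧
      (4 : ZMod (p ^ e)) * (b : ZMod (p ^ e)) = 1 := by
  haveI : NeZero (p ^ e) := ⟨pow_ne_zero _ (Fact.out : p.Prime).ne_zero⟩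
  set u : ZMod (p ^ e) := (2 : ZMod (p ^ e))⁻¹ with hu
  have h2u : 2 * u = 1 := by
    have hcop : Nat.Coprime 2 (p ^ e) := by
      apply Nat.Coprime.pow_right
      exact (Nat.coprime_primes Nat.prime_two (Fact.out)).mpr (Ne.symm hp2)
    have := ZMod.coe_mul_inv_eq_one 2 hcop
    simpa [hu] using this
  let D : SL(2, ZMod (p ^ e)) := ⟨!![2, 0; 0, u], by simp [Matrix.det_fin_two_of, h2u]⟩
  refine ⟨D, (u * u).val, dBar_conj_tBar T h2u D rfl hT, dBar_conj_lBar L h2u D rfl hL (ZMod.natCast_zmod_val _), ?_⟩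
  rw [ZMod.natCast_zmod_val]
  linear_combination (2 * u + 1) * h2u

end layer

section generation

variable (N : ℕ)


/-- The reduction of Mathlib's `T ∈ SL₂(ℤ)` modulo `N` is `(1 1; 0 1)`. [cite: DiamondShurman2005, Exercise
1.1.1] -/
theorem coe_map_T : ((Matrix.SpecialLinearGroup.map (Int.castRingHom (ZMod N)) ModularGroup.T : SL(2, ZMod N)) :
    Matrix (Fin 2) (Fin 2) (ZMod N)) = !![1, 1; 0, 1] := by
  ext i j; fin_cases i <;> fin_cases j <;> simp [ModularGroup.T]


/-- The reduction of `S T⁻¹ S⁻¹ = (1 0; 1 1) ∈ SL₂(ℤ)` modulo `N` is `(1 0; 1 1)`. [cite: DiamondShurman2005,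
Exercise 1.1.1] -/
theorem coe_map_L : ((Matrix.SpecialLinearGroup.map (Int.castRingHom (ZMod N))
      (ModularGroup.S * ModularGroup.T⁻¹ * ModularGroup.S⁻¹) : SL(2, ZMod N)) :
    Matrix (Fin 2) (Fin 2) (ZMod N)) = !![1, 0; 1, 1] := by
  ext i j; fin_cases i <;> fin_cases j <;> simp [ModularGroup.T, ModularGroup.S, Matrix.mul_apply,
    Fin.sum_univ_two, Matrix.SpecialLinearGroup.coe_inv, Matrix.adjugate_fin_two]


/-- **`SL₂(ℤ/N)` is generated by `T̄ = (1 1; 0 1)` and `L̄ = (1 0; 1 1)`** (`N ≥ 1`): image of `SL₂(ℤ) = ⟨S, T⟩`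
(Mathlib `SL2Z_generators`, the cited exercise) under the surjective reduction (tree:
`specialLinearGroup_map_surjective`), with `S ↦ T̄⁻¹ L̄ T̄⁻¹`. [cite: DiamondShurman2005, Exercise 1.1.1] -/
theorem closure_T_L_eq_top [NeZero N] (T L : SL(2, ZMod N))
    (hT : (T : Matrix (Fin 2) (Fin 2) (ZMod N)) = !![1, 1; 0, 1])
    (hL : (L : Matrix (Fin 2) (Fin 2) (ZMod N)) = !![1, 0; 1, 1]) :
    Subgroup.closure ({T, L} : Set SL(2, ZMod N)) = ⊤ := by
  set red := Matrix.SpecialLinearGroup.map (n := Fin 2) (Int.castRingHom (ZMod N)) with hred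
  have hsurj : Function.Surjective red :=
    Literature.NumberTheory.EllipticCurves.ModularForms.specialLinearGroup_map_surjective N
  have hTT : red ModularGroup.T = T := by
    ext i j; rw [hT]
    fin_cases i <;> fin_cases j <;> simp [hred, ModularGroup.T]
  have hSS : red ModularGroup.S = T⁻¹ * L * T⁻¹ := by
    ext i j
    simp only [coe_mul, Matrix.SpecialLinearGroup.coe_inv, hT, hL]
    fin_cases i <;> fin_cases j <;> simp [hred, ModularGroup.S, Matrix.mul_apply, Fin.sum_univ_two,
      Matrix.adjugate_fin_two]
  rw [eq_top_iff]
  have h1 : (⊤ : Subgroup SL(2, ZMod N)) = Subgroup.map red ⊤ := by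
    rw [← MonoidHom.range_eq_map, MonoidHom.range_eq_top.mpr hsurj]
  rw [h1, ← SpecialLinearGroup.SL2Z_generators, MonoidHom.map_closure, Set.image_pair, hSS, hTT,
    Subgroup.closure_le]
  intro x hx
  simp only [Set.mem_insert_iff, Set.mem_singleton_iff] at hx
  have ht : T ∈ Subgroup.closure ({T, L} : Set SL(2, ZMod N)) := Subgroup.subset_closure (by simp)
  have hl : L ∈ Subgroup.closure ({T, L} : Set SL(2, ZMod N)) := Subgroup.subset_closure (by simp)
  rcases hx with rfl | rfl
  · exact Subgroup.mul_mem _ (Subgroup.mul_mem _ (Subgroup.inv_mem _ ht) hl) (Subgroup.inv_mem _ ht)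
  · exact ht


/-- Compatibility of reductions on `SL₂`: `(ℤ/N → ℤ/d) ∘ (ℤ → ℤ/N) = (ℤ → ℤ/d)` for `d ∣ N`. [cite:
DiamondShurman2005, Exercise 1.2.2] -/
theorem map_castHom_comp_map_intCast {d : ℕ} (h : d ∣ N) :
    (Matrix.SpecialLinearGroup.map (ZMod.castHom h (ZMod d))).comp
        (Matrix.SpecialLinearGroup.map (n := Fin 2) (Int.castRingHom (ZMod N))) =
      Matrix.SpecialLinearGroup.map (Int.castRingHom (ZMod d)) := by
  ext g i j
  simp [-ZMod.castHom_apply, map_intCast]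

/-- Pointwise form of `map_castHom_comp_map_intCast`. [cite: DiamondShurman2005, Exercise 1.2.2] -/
theorem map_castHom_map_intCast {d : ℕ} (h : d ∣ N) (g : SL(2, ℤ)) :
    Matrix.SpecialLinearGroup.map (ZMod.castHom h (ZMod d))
        (Matrix.SpecialLinearGroup.map (Int.castRingHom (ZMod N)) g) =
      Matrix.SpecialLinearGroup.map (Int.castRingHom (ZMod d)) g := by
  rw [← MonoidHom.comp_apply, map_castHom_comp_map_intCast N h]

/-- The reduction `SL₂(ℤ/N) → SL₂(ℤ/d)` (`d ∣ N`, `d ≥ 1`) is onto, since `SL₂(ℤ) → SL₂(ℤ/d)` is. [cite: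
DiamondShurman2005, Exercise 1.2.2] -/
theorem map_castHom_surjective {d : ℕ} [NeZero d] (h : d ∣ N) :
    Function.Surjective (Matrix.SpecialLinearGroup.map (n := Fin 2) (ZMod.castHom h (ZMod d))) := by
  intro x
  obtain ⟨g, hg⟩ := Literature.NumberTheory.EllipticCurves.ModularForms.specialLinearGroup_map_surjective d x
  exact ⟨Matrix.SpecialLinearGroup.map (Int.castRingHom (ZMod N)) g, by rw [map_castHom_map_intCast N h, hg]⟩


/-- The kernel of `SL₂(ℤ) → SL₂(ℤ/N)` is Mathlib's principal congruence subgroup `Γ(N)`. [cite: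
DiamondShurman2005, §1.2] -/
theorem mem_ker_map_intCast_iff (g : SL(2, ℤ)) :
    g ∈ (Matrix.SpecialLinearGroup.map (n := Fin 2) (Int.castRingHom (ZMod N))).ker ↔
      g ∈ CongruenceSubgroup.Gamma N := by
  rw [MonoidHom.mem_ker, CongruenceSubgroup.Gamma_mem']

end generation

end SL2TopLayer

end Literature.GroupTheory.ArithmeticGroups
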